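import Mathlib
import HarnessLib
import Summits.HubbardSuperconductivity.HubbardSuperconductivity.Theorems.KLProgrammeH10TwoPointLimitSymbolProductSampled

/-!
# Route `KLProgramme` — engine support (route (L2)): FIRST differences of the sampled product symbol `G(k₀² + e²)·Z` — the order-one twins of
# the p4 lineage's `KLProgrammeH10TwoPointLimitSymbolProductSampled` (time and integer-step space directions, same hypothesis lists)

Cell `gate-hubbard-kl`, seat hubbard-kl-k3c2-p3; gen-4 ENGINE child stmt-HubbardSuperconductivity-19855 (`stub_engine_step_norms`, propagator
`α_n`).  The per-pair assembly `slicePair_charSum_l1_le` splits the sector-pair symbol as `M·Ψ̂` (multiplier product × slice profile) by the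
discrete Leibniz rule, whose cross term needs the multiplier's FIRST differences `‖Δ_w M‖ ≤ a₁(w)` at their true (anisotropic) size; the p4
lineage's product-sampled layer exports sup and SECOND differences (all its own consumer `B` needs).  Here are the first-order twins, with the
same objects and hypotheses (so one instance serves both):

* `abs_deriv_symbol_timeLine_le` — `|∂ₛ[G((k₀ + s h₀)² + c)·z]| ≤ 2g₁|h₀||z|/Λ`;
* **`norm_fwdDiff_time_sampledSymbol_le`** — `‖Δ_{(1,0)} G̃(q)‖ ≤ 2g₁|h₀|z₀/Λ` (window two steps inside, as in the second-order lemma);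
* **`norm_fwdDiff_space_sampledSymbol_le`** — `‖Δ_{(0,ū)} G̃(q)‖ ≤ 2g₁τz₀/Λ + g₀z₁`, `τ = τ₀ + K₂(ρ + 2‖w‖)‖w‖`, under the hypothesis list of
  `norm_fwdDiff_two_space_sampledSymbol_le` verbatim.

Everything is proved; no definitions, no named facts. [folklore]

References: G. Benfatto, A. Giuliani, V. Mastropietro, Ann. Henri Poincaré 7 (2006) 809–898, §2.5 proof of Lemma 2.2 (2.52)–(2.56).
-/

noncomputable section

namespace Summit.HubbardSuperconductivity.HubbardSuperconductivity.Theorems.TorusFourierL2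

set_option linter.dupNamespace false -- summit = problem name (single-conjunct summit), D-0017

open Set Finset Filter Topology Literature.Probability.LatticeModels Literature.Analysis.Calculus
open scoped Real

/-! ### §1 The time line at order one -/

/-- **First derivative along the Matsubara line**: `|∂ₛ[G((k₀ + s h₀)² + c)·z]| ≤ 2g₁|h₀||z|/Λ`.
[cite: BenfattoGiulianiMastropietro2006, §2.5 proof of Lemma 2.2 (2.52)] -/
theorem abs_deriv_symbol_timeLine_le {G : ℝ → ℝ} (hG : ContDiff ℝ 2 G) {Λ g₁ : ℝ} (hΛ : 0 < Λ) (hg₁ : 0 ≤ g₁)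
    (hG1 : ∀ u, |deriv G u| ≤ g₁ / Λ ^ 2) (hGv : ∀ u, Λ ^ 2 < u → G u = 0) {c : ℝ} (hc : 0 ≤ c) (k₀ h₀ z s : ℝ) :
    |deriv (fun s : ℝ => G ((k₀ + s * h₀) ^ 2 + c) * z) s| ≤ 2 * g₁ * |h₀| * |z| / Λ := by
  have hφ : ContDiff ℝ 2 fun s : ℝ => k₀ + s * h₀ := contDiff_const.add (contDiff_id.mul contDiff_const)
  have hA : ContDiff ℝ 2 (fun s => G ((k₀ + s * h₀) ^ 2 + c)) := hG.comp (contDiff_two_sq_add hφ c)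
  have hmul : (fun s : ℝ => G ((k₀ + s * h₀) ^ 2 + c) * z) = fun s => z * G ((k₀ + s * h₀) ^ 2 + c) := by
    funext s; ring
  rw [hmul, deriv_const_mul z (hA.differentiable (by norm_num) s), abs_mul]
  have hd1 : deriv (fun s : ℝ => k₀ + s * h₀) s = h₀ := by
    have : HasDerivAt (fun s : ℝ => k₀ + s * h₀) (1 * h₀) s := ((hasDerivAt_id s).mul_const h₀).const_add k₀
    rw [this.deriv]; ring
  have h := abs_deriv_radialComp_le (φ := fun s : ℝ => k₀ + s * h₀) hG hφ hΛ hg₁ hG1 hGv hc s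
  rw [hd1] at h
  calc |z| * |deriv (fun s => G ((k₀ + s * h₀) ^ 2 + c)) s| ≤ |z| * (2 * g₁ * |h₀| / Λ) :=
        mul_le_mul_of_nonneg_left h (abs_nonneg _)
    _ = _ := by ring

section Sampled

variable {P L : ℕ} [NeZero P] [NeZero L]

omit [NeZero L] in
/-- **Time direction, first difference, pointwise**: with the frequency window two steps inside the kept frequencies,
`‖Δ_{(1,0)} G̃(q)‖ ≤ 2g₁|h₀|z₀/Λ` for every `q`. [cite: BenfattoGiulianiMastropietro2006, §2.5 Lemma 2.2 (2.52), (2.56)] -/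
theorem norm_fwdDiff_time_sampledSymbol_le {G : ℝ → ℝ} (hG : ContDiff ℝ 2 G) {Λ g₁ z₀ : ℝ} (hΛ : 0 < Λ)
    (hg₁ : 0 ≤ g₁) (hG1 : ∀ u, |deriv G u| ≤ g₁ / Λ ^ 2)
    (hGv : ∀ u, Λ ^ 2 < u → G u = 0) (e Z : (Fin 2 → ℝ) → ℝ) (hZ0 : ∀ p, |Z p| ≤ z₀)
    (Φ : ℝ × (Fin 2 → ℝ) → ℂ) (hΦ : ∀ k₀ p, Φ (k₀, p) = ((G (k₀ ^ 2 + e p ^ 2) * Z p : ℝ) : ℂ)) (a₀ h₀ hx : ℝ)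
    (hwin : ∀ m : ℤ, (m < 2 ∨ (P : ℤ) ≤ m + 2) → Λ < |a₀ + h₀ * (m : ℝ)|)
    (Gs : TorusSite 1 P × TorusSite 2 L → ℂ)
    (hGs : ∀ q, Gs q = Φ (a₀ + h₀ * (((q.1 0).val : ℕ) : ℝ), fun j => hx * (((q.2 j).valMinAbs : ℤ) : ℝ)))
    (q : TorusSite 1 P × TorusSite 2 L) :
    ‖fwdDiff ((fun _ : Fin 1 => (1 : ZMod P)), (0 : TorusSite 2 L)) Gs q‖ ≤ 2 * g₁ * |h₀| * z₀ / Λ := by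
  -- the window (one step suffices; the two-step hypothesis implies it)
  have hsupp : ∀ (m : ℤ) (k : Fin 2 → ℝ), (m < (1 : ℕ) ∨ (P : ℤ) ≤ m + (1 : ℕ)) → Φ (a₀ + h₀ * (m : ℝ), k) = 0 := by
    intro m k hm
    have hm' : m < 2 ∨ (P : ℤ) ≤ m + 2 := by
      rcases hm with h | h
      · left; have : m < 1 := by exact_mod_cast h
        omega
      · right; have : (P : ℤ) ≤ m + 1 := by exact_mod_cast h
        omega
    have hlt := hwin m hm'
    rw [hΦ]
    have hu : Λ ^ 2 < (a₀ + h₀ * (m : ℝ)) ^ 2 + e k ^ 2 := by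
      have h1 : Λ ^ 2 < (a₀ + h₀ * (m : ℝ)) ^ 2 := by
        have := sq_lt_sq' (by linarith [abs_nonneg (a₀ + h₀ * (m : ℝ))]) hlt
        rw [sq_abs] at this; exact this
      nlinarith
    rw [hGv _ hu, zero_mul, Complex.ofReal_zero]
  set k₀ : ℝ := a₀ + h₀ * (((q.1 0).val : ℕ) : ℝ) with hk₀
  set k : Fin 2 → ℝ := fun j => hx * (((q.2 j).valMinAbs : ℤ) : ℝ) with hk
  have hline : (fun s : ℝ => Φ (((k₀, k) : ℝ × (Fin 2 → ℝ)) + s • ((h₀, 0) : ℝ × (Fin 2 → ℝ)))) =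
      fun s => (((G ((k₀ + s * h₀) ^ 2 + e k ^ 2) * Z k : ℝ)) : ℂ) := by
    funext s; rw [timeLine_apply, hΦ]
  have hreal : ContDiff ℝ 2 fun s : ℝ => G ((k₀ + s * h₀) ^ 2 + e k ^ 2) * Z k := contDiff_two_symbol_timeLine hG _ _ _ _
  have hreal1 : ContDiff ℝ 1 fun s : ℝ => G ((k₀ + s * h₀) ^ 2 + e k ^ 2) * Z k := hreal.of_le (by norm_num)
  have hC : ContDiff ℝ 1 fun s : ℝ => Φ (((k₀, k) : ℝ × (Fin 2 → ℝ)) + s • ((h₀, 0) : ℝ × (Fin 2 → ℝ))) := by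
    rw [hline]; exact Complex.ofRealCLM.contDiff.comp hreal1
  have h := norm_fwdDiff_iter_time_apply_le Φ a₀ h₀ hx 1 Gs hGs hsupp q hC (K := 2 * g₁ * |h₀| * z₀ / Λ) fun s _ => ?_
  · simpa only [Function.iterate_one] using h
  rw [hline, norm_iteratedDeriv_ofReal_comp hreal1, iteratedDeriv_one]
  have h1 := abs_deriv_symbol_timeLine_le hG hΛ hg₁ hG1 hGv (sq_nonneg (e k)) k₀ h₀ (Z k) s
  have hZk := hZ0 k
  calc _ ≤ 2 * g₁ * |h₀| * |Z k| / Λ := h1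
    _ ≤ 2 * g₁ * |h₀| * z₀ / Λ := by gcongr

/-- **Space direction along an integer step, first difference, pointwise** — the order-one twin of `norm_fwdDiff_two_space_sampledSymbol_le`
with the same hypothesis list: `‖Δ_{(0,ū)} G̃(q)‖ ≤ 2g₁τz₀/Λ + g₀z₁`, `τ = τ₀ + K₂(ρ + 2‖w‖)‖w‖`, for every `q`.
[cite: BenfattoGiulianiMastropietro2006, §2.5 Lemma 2.2 (2.53)–(2.56)] -/
theorem norm_fwdDiff_space_sampledSymbol_le {G : ℝ → ℝ} (hG : ContDiff ℝ 2 G) {Λ g₀ g₁ : ℝ} (hΛ : 0 < Λ)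
    (hg₀ : 0 ≤ g₀) (hg₁ : 0 ≤ g₁) (hG0 : ∀ u, |G u| ≤ g₀) (hG1 : ∀ u, |deriv G u| ≤ g₁ / Λ ^ 2)
    (hGv : ∀ u, Λ ^ 2 < u → G u = 0)
    {e : (Fin 2 → ℝ) → ℝ} (he : ContDiff ℝ 2 e) {K₂ : ℝ} (hK₂ : ∀ p, ‖iteratedFDeriv ℝ 2 e p‖ ≤ K₂)
    {Z : (Fin 2 → ℝ) → ℝ} (hZ : ContDiff ℝ 2 Z) {z₀ z₁ : ℝ} (hz₀ : 0 ≤ z₀) (hz₁ : 0 ≤ z₁)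
    (hZ0 : ∀ p, |Z p| ≤ z₀) (w : Fin 2 → ℝ)
    (hZ1 : ∀ (p₀ : Fin 2 → ℝ) (s : ℝ), |e (p₀ + s • w)| ≤ Λ → |deriv (fun s : ℝ => Z (p₀ + s • w)) s| ≤ z₁)
    {pF : Fin 2 → ℝ} {ρ τ₀ zm : ℝ} (hρ : 0 ≤ ρ) (hτ₀ : |fderiv ℝ e pF w| ≤ τ₀)
    (hcell : ∀ p : Fin 2 → ℝ, (∀ i, |p i| ≤ π + zm) → |e p| ≤ Λ → Z p ≠ 0 → ‖p - pF‖ ≤ ρ)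
    (Φ : ℝ × (Fin 2 → ℝ) → ℂ) (hΦ : ∀ k₀ p, Φ (k₀, p) = ((G (k₀ ^ 2 + e p ^ 2) * Z p : ℝ) : ℂ)) (a₀ h₀ hx : ℝ)
    (u : Fin 2 → ℤ) (hw : w = fun j => hx * (u j : ℝ)) (hu : ∀ j, 2 * |hx| * |(u j : ℝ)| ≤ zm)
    (hzone : ∀ p : Fin 2 → ℝ, (∃ j, π - zm ≤ |p j|) → Λ < |e p|) (hxL : |hx| * L = 2 * π)
    (Gs : TorusSite 1 P × TorusSite 2 L → ℂ)
    (hGs : ∀ q, Gs q = Φ (a₀ + h₀ * (((q.1 0).val : ℕ) : ℝ), fun j => hx * (((q.2 j).valMinAbs : ℤ) : ℝ)))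
    (q : TorusSite 1 P × TorusSite 2 L) :
    ‖fwdDiff ((0 : TorusSite 1 P), (fun j => ((u j : ℤ) : ZMod L))) Gs q‖ ≤
      2 * g₁ * (τ₀ + K₂ * (ρ + 2 * ‖w‖) * ‖w‖) / Λ * z₀ + g₀ * z₁ := by
  have hK0 : 0 ≤ K₂ := le_trans (norm_nonneg _) (hK₂ pF)
  have hτ0' : 0 ≤ τ₀ := le_trans (abs_nonneg _) hτ₀
  set τ : ℝ := τ₀ + K₂ * (ρ + 2 * ‖w‖) * ‖w‖ with hτ
  have hτpos : 0 ≤ τ := by positivity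
  have hRHS : 0 ≤ 2 * g₁ * τ / Λ * z₀ + g₀ * z₁ := by positivity
  -- the zone: `Φ(k₀, hₓ m) = 0` whenever `2|m_j| + 4|u_j| ≥ L` (hence also whenever `2|m_j| + 2|u_j| ≥ L`)
  have hL : (0 : ℝ) < L := Nat.cast_pos.2 (Nat.pos_of_ne_zero (NeZero.ne L))
  have hzone' : ∀ (k₀ : ℝ) (m : Fin 2 → ℤ), (∃ j, (L : ℤ) ≤ 2 * |m j| + 2 * (2 : ℕ) * |u j|) →
      Φ (k₀, fun j => hx * (m j : ℝ)) = 0 := by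
    intro k₀ m ⟨j, hj⟩
    have hj' : (L : ℝ) ≤ 2 * |(m j : ℝ)| + 4 * |(u j : ℝ)| := by
      have := hj; push_cast at this ⊢; rw [← Int.cast_abs, ← Int.cast_abs]; exact_mod_cast (by linarith : (L:ℤ) ≤ 2*|m j| + 4*|u j|)
    have hpj : π - zm ≤ |hx * (m j : ℝ)| := by
      rw [abs_mul]
      have h1 : |hx| * L ≤ |hx| * (2 * |(m j : ℝ)| + 4 * |(u j : ℝ)|) := mul_le_mul_of_nonneg_left hj' (abs_nonneg _)
      have h2 := hu j
      nlinarith [abs_nonneg hx, abs_nonneg (m j : ℝ)]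
    have hbig := hzone (fun j => hx * (m j : ℝ)) ⟨j, hpj⟩
    rw [hΦ]
    have hu' : Λ ^ 2 < k₀ ^ 2 + e (fun j => hx * (m j : ℝ)) ^ 2 := by
      have := sq_lt_sq' (by linarith [abs_nonneg (e fun j => hx * (m j : ℝ))]) hbig
      rw [sq_abs] at this; nlinarith
    rw [hGv _ hu', zero_mul, Complex.ofReal_zero]
  have hzone1 : ∀ (k₀ : ℝ) (m : Fin 2 → ℤ), (∃ j, (L : ℤ) ≤ 2 * |m j| + 2 * (1 : ℕ) * |u j|) →
      Φ (k₀, fun j => hx * (m j : ℝ)) = 0 := by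
    intro k₀ m ⟨j, hj⟩
    refine hzone' k₀ m ⟨j, ?_⟩
    have : 0 ≤ |u j| := abs_nonneg _
    push_cast at hj ⊢
    linarith
  -- trivial case: both samples vanish
  by_cases hall : ∀ t : ℕ, t ≤ 1 → Gs (q + t • ((0 : TorusSite 1 P), fun j => ((u j : ℤ) : ZMod L))) = 0
  · have h0 := fwdDiff_iter_eq_zero_of_forall Gs ((0 : TorusSite 1 P), fun j => ((u j : ℤ) : ZMod L)) 1 q hall
    rw [Function.iterate_one] at h0
    rw [h0, norm_zero]
    exact hRHS
  push Not at hall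
  obtain ⟨t, ht, hne⟩ := hall
  have ht2 : t ≤ 2 := ht.trans (by norm_num)
  -- the sample point and the straight segment
  set k₀ : ℝ := a₀ + h₀ * (((q.1 0).val : ℕ) : ℝ) with hk₀
  set k : Fin 2 → ℝ := fun j => hx * (((q.2 j).valMinAbs : ℤ) : ℝ) with hk
  have hpt : Φ (k₀, k + (t : ℝ) • w) ≠ 0 := by
    rw [hw]; exact sampledSymbol_shift_ne_zero Φ a₀ h₀ hx u hzone' Gs hGs q ht2 hne
  rw [hΦ] at hpt
  obtain ⟨-, het, hZt⟩ := symbol_support hΛ hGv e Z (fun h0 => hpt (by rw [h0]; simp))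
  have hsq : ∀ i, |(k + (t : ℝ) • w) i| ≤ π + zm := by
    intro i
    have h1 : |k i| ≤ π := abs_sample_le_pi hxL q.2 i
    have h2 : |((t : ℝ) • w) i| ≤ zm := by
      rw [Pi.smul_apply, smul_eq_mul, abs_mul, hw]
      have ht' : |(t : ℝ)| ≤ 2 := by rw [abs_of_nonneg (Nat.cast_nonneg t)]; exact_mod_cast ht2
      calc |(t : ℝ)| * |hx * (u i : ℝ)| ≤ 2 * |hx * (u i : ℝ)| := mul_le_mul_of_nonneg_right ht' (abs_nonneg _)
        _ = 2 * |hx| * |(u i : ℝ)| := by rw [abs_mul]; ring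
        _ ≤ zm := hu i
    calc |(k + (t : ℝ) • w) i| = |k i + ((t : ℝ) • w) i| := rfl
      _ ≤ |k i| + |((t : ℝ) • w) i| := abs_add_le _ _
      _ ≤ π + zm := add_le_add h1 h2
  have hnear_t : ‖k + (t : ℝ) • w - pF‖ ≤ ρ := hcell _ hsq het hZt
  -- every point of the segment `s ∈ [0, 1]` is within `ρ + 2‖w‖` of `p_F`
  have hnear : ∀ s ∈ Set.Icc (0 : ℝ) 1, ‖k + s • w - pF‖ ≤ ρ + 2 * ‖w‖ := by
    intro s hs
    have hts : |s - (t : ℝ)| ≤ 2 := by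
      have ht' : (t : ℝ) ≤ 1 := by exact_mod_cast ht
      have ht0 : (0 : ℝ) ≤ t := Nat.cast_nonneg t
      rw [abs_le]; constructor <;> linarith [hs.1, hs.2]
    calc ‖k + s • w - pF‖ = ‖(k + (t : ℝ) • w - pF) + (s - (t : ℝ)) • w‖ := by congr 1; rw [sub_smul]; abel
      _ ≤ ‖k + (t : ℝ) • w - pF‖ + ‖(s - (t : ℝ)) • w‖ := norm_add_le _ _
      _ ≤ ρ + 2 * ‖w‖ := by
          rw [norm_smul, Real.norm_eq_abs]
          exact add_le_add hnear_t (mul_le_mul_of_nonneg_right hts (norm_nonneg _))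
  -- the line function
  have hline : (fun s : ℝ => Φ (((k₀, k) : ℝ × (Fin 2 → ℝ)) + s • (((0 : ℝ), w) : ℝ × (Fin 2 → ℝ)))) =
      fun s => (((G (e (k + s • w) ^ 2 + k₀ ^ 2) * Z (k + s • w) : ℝ)) : ℂ) := by
    funext s; rw [spaceLine_apply, hΦ]; push_cast; ring
  have hZl : ContDiff ℝ 2 fun s : ℝ => Z (k + s • w) := hZ.comp (contDiff_const.add (contDiff_id.smul contDiff_const))
  have hreal : ContDiff ℝ 2 fun s : ℝ => G (e (k + s • w) ^ 2 + k₀ ^ 2) * Z (k + s • w) :=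
    contDiff_two_radialComp_mul hG (contDiff_two_line he k w) hZl _
  have hreal1 : ContDiff ℝ 1 fun s : ℝ => G (e (k + s • w) ^ 2 + k₀ ^ 2) * Z (k + s • w) := hreal.of_le (by norm_num)
  have hC : ContDiff ℝ 1 fun s : ℝ => Φ (((k₀, k) : ℝ × (Fin 2 → ℝ)) + s • (((0 : ℝ), w) : ℝ × (Fin 2 → ℝ))) := by
    rw [hline]; exact Complex.ofRealCLM.contDiff.comp hreal1
  have hstep : (((0 : ℝ), w) : ℝ × (Fin 2 → ℝ)) = ((0 : ℝ), fun j => hx * (u j : ℝ)) := by rw [hw]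
  have hmain : ∀ s ∈ Set.Icc (0 : ℝ) ((1 : ℕ) : ℝ), ‖iteratedDeriv 1 (fun s : ℝ =>
      Φ (((k₀, k) : ℝ × (Fin 2 → ℝ)) + s • (((0 : ℝ), w) : ℝ × (Fin 2 → ℝ)))) s‖ ≤ 2 * g₁ * τ / Λ * z₀ + g₀ * z₁ := by
    intro s hs'
    have hs : s ∈ Set.Icc (0 : ℝ) 1 := by simpa using hs'
    rw [hline, norm_iteratedDeriv_ofReal_comp hreal1, iteratedDeriv_one]
    by_cases hsupp : Λ ^ 2 < e (k + s • w) ^ 2 + k₀ ^ 2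
    · rw [(radialComp_mul_eq_zero_of_lt hG (contDiff_two_line he k w) hZl hGv (k₀ ^ 2) hsupp).2.1, abs_zero]
      exact hRHS
    · push Not at hsupp
      have hes : |e (k + s • w)| ≤ Λ := abs_le_of_sq_add_le (sq_nonneg k₀) hΛ.le hsupp
      have h := abs_deriv_symbol_spaceLine_le he hG hZl hΛ hg₁ hG0 hG1 hGv (sq_nonneg k₀) k w s
      have hdir : |fderiv ℝ e (k + s • w) w| ≤ τ := by
        have h1 := abs_fderiv_apply_le_of_near he hK₂ pF (k + s • w) w
        have h2 : K₂ * ‖k + s • w - pF‖ * ‖w‖ ≤ K₂ * (ρ + 2 * ‖w‖) * ‖w‖ :=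
          mul_le_mul_of_nonneg_right (mul_le_mul_of_nonneg_left (hnear s hs) hK0) (norm_nonneg _)
        rw [hτ]; linarith
      have hZ1s := hZ1 k s hes
      have hZ0s := hZ0 (k + s • w)
      calc _ ≤ 2 * g₁ * |fderiv ℝ e (k + s • w) w| / Λ * |Z (k + s • w)| + g₀ * |deriv (fun s : ℝ => Z (k + s • w)) s| := h
        _ ≤ 2 * g₁ * τ / Λ * z₀ + g₀ * z₁ := by gcongr
  rw [hstep] at hC hmain
  have h := norm_fwdDiff_iter_space_apply_le Φ a₀ h₀ hx 1 Gs hGs u hzone1 q hC hmain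
  simpa only [Function.iterate_one] using h

end Sampled

end Summit.HubbardSuperconductivity.HubbardSuperconductivity.Theorems.TorusFourierL2

end
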